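/-
Copyright (c) 2026 the pub-hodgecm-mathlib formalisation cell (harness21).  Prover seat hodgecm-mathlib-K2E3-p14 (g4) ((SC-an) line lead), HCML Track B «K2-LIT»
(build stream 29), h413 = `stmt-HodgeConjecture-24833`, line `K2_E3_EllipticInputs`, unit U12 «Characters», road «FC» (FINITE CONJUGATION MEASURE, RULINGS #15 ∕ MAP v5),
helper for brick (FC-8) F3 «the sum over the Cartan shells converges».  2026-09-04.
-/
import Mathlib.Analysis.SpecificLimits.Basic
import Mathlib.Analysis.SpecialFunctions.Pow.NNReal
import HarnessLib

/-!
# h413 ∕ Track B «K2-LIT», road «FC», helper for (FC-8) F3: GEOMETRIC TAILS IN `ℝ≥0∞` — a series with finite terms and an eventually geometric (or eventually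
# `ρ^{k(n)}`, `4 k(n) + c ≥ n`) majorant has a finite sum

Cell `pub/hodgecm-mathlib`, crux H413 = `stmt-HodgeConjecture-24833`; lane `--supports stmt-HodgeConjecture-24833 --as helper` (count-neutral).  THEOREMS ONLY; Mathlib-only
imports.  (SC-an) line lead K2E3-p14 (g4), RULINGS #15 (R15-1)(vi): in the assembly `finConj` (K2E3-p23 (g4), `K2E3FinConjRankOne`) the bound reads
`∫∫ ≤ Mb · Σ_n μ(K₀ t_n K₀) · sup_{x ∈ K₀t_nK₀} μ(box_n ∩ Zc)` (★ FC-8a p857179), each term is finite, and for `n ≥ n₀` the term is `≤ B · ρ^{k(n)}` with `ρ = q^{−κ} < 1`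
(★ FC-5 p857212 ∕ FC-5b p857248 over ★ FC-D) and `k(n) = ⌊(n − 5M − 2)∕4⌋` (★ FC-6 p857249, `5M + 4k + 2 ≤ n`).  This file is the bookkeeping that such a series is `< ⊤`.

* `tsum_lt_top_of_le_geometric_tail` — `a n ≠ ⊤`, `a n ≤ B r^n` for `n ≥ n₀`, `B ≠ ⊤`, `r < 1` ⇒ `Σ a < ⊤`;
* `pow_floor_le_rpow_pow` — `ρ^{k} ≤ (ρ^{1∕4})^{n} · ((ρ^{1∕4})^{c})⁻¹` when `n ≤ 4k + c`, `0 < ρ ≤ 1`;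
* `tsum_lt_top_of_le_pow_of_linear` — the `ρ^{k(n)}` form consumed by F3;
* `rpow_inv_pow_natCast` — `((q⁻¹)^k)^κ = ((q⁻¹)^κ)^k` in `ℝ≥0∞` (the FC-5 radius `ε = q^{−k}` raised to the FC-D exponent `κ`).

HONEST LABEL.  HC_CM is proved only modulo the 7 printed citations (2 remaining named inputs: hLiu418 = `stmt-HodgeConjecture-24832`, h413 = `stmt-HodgeConjecture-24833`)
until rung 0 closes; count-neutral helper (pure `ℝ≥0∞` analysis).

## References
* [Rudin1976] W. Rudin, *Principles of Mathematical Analysis* (3rd ed., 1976), Thm. 3.26 (geometric series), Thm. 3.25 (comparison).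
-/

set_option autoImplicit false
-- the mandated namespace repeats the single-problem summit's segment (`HodgeConjecture.HodgeConjecture`)
set_option linter.dupNamespace false

noncomputable section

open scoped ENNReal NNReal
open Finset

namespace Summit.HodgeConjecture.HodgeConjecture.Cruxes.H413.K2E3GeometricTailSummable

/-- **Finite terms + eventually geometric majorant ⇒ finite sum** (in `ℝ≥0∞`): if `a n ≠ ⊤` for all `n`, `B ≠ ⊤`, `r < 1` and `a n ≤ B · rⁿ` for `n ≥ n₀`, then
`Σ' a < ⊤`. [cite: Rudin1976, Thm. 3.26] -/
theorem tsum_lt_top_of_le_geometric_tail {a : ℕ → ℝ≥0∞} (ha : ∀ n, a n ≠ ⊤) {B r : ℝ≥0∞} (hB : B ≠ ⊤) (hr : r < 1) {n₀ : ℕ}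
    (h : ∀ n, n₀ ≤ n → a n ≤ B * r ^ n) : ∑' n, a n < ⊤ := by
  classical
  -- split `a ≤ c + B r^n` with `c` supported on `range n₀`
  set c : ℕ → ℝ≥0∞ := fun n => if n < n₀ then a n else 0 with hc
  have hle : ∀ n, a n ≤ c n + B * r ^ n := by
    intro n
    by_cases hn : n < n₀
    · rw [hc]; simp only [hn, ↓reduceIte]; exact le_self_add
    · rw [hc]; simp only [hn, ↓reduceIte, zero_add]; exact h n (not_lt.1 hn)
  have hcsum : ∑' n, c n = ∑ n ∈ range n₀, c n := by
    refine tsum_eq_sum fun n hn => ?_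
    rw [hc]; simp only [mem_range] at hn; simp [hn]
  have hcfin : ∑' n, c n < ⊤ := by
    rw [hcsum]
    refine ENNReal.sum_lt_top.2 fun n _ => ?_
    rw [hc]
    show (if n < n₀ then a n else 0) < ⊤
    split_ifs
    · exact (ha n).lt_top
    · exact ENNReal.zero_lt_top
  have hgeo : ∑' n, B * r ^ n < ⊤ := by
    rw [ENNReal.tsum_mul_left, ENNReal.tsum_geometric]
    refine ENNReal.mul_lt_top hB.lt_top ?_
    rw [ENNReal.inv_lt_top, tsub_pos_iff_lt]
    exact hr
  calc ∑' n, a n ≤ ∑' n, (c n + B * r ^ n) := ENNReal.tsum_le_tsum hle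
    _ = ∑' n, c n + ∑' n, B * r ^ n := ENNReal.tsum_add
    _ < ⊤ := ENNReal.add_lt_top.2 ⟨hcfin, hgeo⟩

/-- `ρ^k ≤ (ρ^{1∕4})ⁿ · ((ρ^{1∕4})^c)⁻¹` when `n ≤ 4k + c` and `0 < ρ ≤ 1`, `ρ ≠ ⊤` (so `ρ^k = (ρ^{1∕4})^{4k} ≤ (ρ^{1∕4})^{n − c}`). [cite: Rudin1976, Thm. 3.25] -/
theorem pow_le_rpow_quarter_pow {ρ : ℝ≥0∞} (hρ0 : ρ ≠ 0) (hρ1 : ρ ≤ 1) (hρT : ρ ≠ ⊤) {n k c : ℕ} (hk : n ≤ 4 * k + c) :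
    ρ ^ k ≤ (ρ ^ (1 / 4 : ℝ)) ^ n * ((ρ ^ (1 / 4 : ℝ)) ^ c)⁻¹ := by
  set s : ℝ≥0∞ := ρ ^ (1 / 4 : ℝ) with hs
  have hs0 : s ≠ 0 := by
    rw [hs]; exact (ENNReal.rpow_pos (pos_iff_ne_zero.2 hρ0) hρT).ne'
  have hsT : s ≠ ⊤ := ENNReal.rpow_ne_top_of_nonneg (by norm_num) hρT
  have hs1 : s ≤ 1 := ENNReal.rpow_le_one hρ1 (by norm_num)
  have hρs : ρ = s ^ 4 := by
    rw [hs, ← ENNReal.rpow_natCast, ← ENNReal.rpow_mul]; norm_num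
  -- `ρ^k = s^{4k} ≤ s^{n - c}` and `s^{n-c} · s^c ≥ s^n`… in the form `s^{4k} * s^c ≤? ` — use `n ≤ 4k + c` directly:
  have h1 : ρ ^ k * s ^ c ≤ s ^ n := by
    rw [hρs, ← pow_mul, ← pow_add]
    exact pow_le_pow_right_of_le_one' hs1 (by omega)
  have hsc : s ^ c ≠ 0 := pow_ne_zero _ hs0
  have hscT : s ^ c ≠ ⊤ := ENNReal.pow_ne_top hsT
  calc ρ ^ k = ρ ^ k * s ^ c * (s ^ c)⁻¹ := by rw [mul_assoc, ENNReal.mul_inv_cancel hsc hscT, mul_one]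
    _ ≤ s ^ n * (s ^ c)⁻¹ := mul_le_mul' h1 le_rfl

/-- **Finite terms + an eventual majorant `B · ρ^{k(n)}` with `n ≤ 4 k(n) + c` ⇒ finite sum** (`0 < ρ < 1`, `B, ρ ≠ ⊤`): the shape of the FC-8 shell sum
(`k(n) = ⌊(n − 5M − 2)∕4⌋`). [cite: Rudin1976, Thm. 3.26] -/
theorem tsum_lt_top_of_le_pow_of_linear {a : ℕ → ℝ≥0∞} (ha : ∀ n, a n ≠ ⊤) {B ρ : ℝ≥0∞} (hB : B ≠ ⊤) (hρ0 : ρ ≠ 0) (hρ1 : ρ < 1) {n₀ c : ℕ}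
    {k : ℕ → ℕ} (hk : ∀ n, n₀ ≤ n → n ≤ 4 * k n + c) (h : ∀ n, n₀ ≤ n → a n ≤ B * ρ ^ k n) : ∑' n, a n < ⊤ := by
  have hρT : ρ ≠ ⊤ := (hρ1.trans ENNReal.one_lt_top).ne
  set s : ℝ≥0∞ := ρ ^ (1 / 4 : ℝ) with hs
  have hs1 : s < 1 := ENNReal.rpow_lt_one hρ1 (by norm_num)
  have hsT : s ≠ ⊤ := ENNReal.rpow_ne_top_of_nonneg (by norm_num) hρT
  have hscT : (s ^ c)⁻¹ ≠ ⊤ := by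
    rw [ne_eq, ENNReal.inv_eq_top]
    exact pow_ne_zero _ (by rw [hs]; exact (ENNReal.rpow_pos (pos_iff_ne_zero.2 hρ0) hρT).ne')
  refine tsum_lt_top_of_le_geometric_tail ha (B := B * (s ^ c)⁻¹) (ENNReal.mul_ne_top hB hscT) hs1 (n₀ := n₀) fun n hn => ?_
  calc a n ≤ B * ρ ^ k n := h n hn
    _ ≤ B * (s ^ n * (s ^ c)⁻¹) := mul_le_mul' le_rfl (pow_le_rpow_quarter_pow hρ0 hρ1.le hρT (hk n hn))
    _ = B * (s ^ c)⁻¹ * s ^ n := by ring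

/-- `((q⁻¹)^k)^κ = ((q⁻¹)^κ)^k` in `ℝ≥0∞` for a real exponent `κ` — the FC-5 radius `ε = q^{−k}` raised to the FC-D exponent. [cite: Rudin1976, Thm. 3.25] -/
theorem rpow_pow_comm (x : ℝ≥0∞) (k : ℕ) (κ : ℝ) : (x ^ k) ^ κ = (x ^ κ) ^ k := by
  rw [← ENNReal.rpow_natCast, ← ENNReal.rpow_mul, mul_comm, ENNReal.rpow_mul, ENNReal.rpow_natCast]

/-- For `1 < q` (e.g. the residue cardinality, `q ≠ ⊤`) and `0 < κ`: `ρ := (q⁻¹)^κ` satisfies `ρ ≠ 0` and `ρ < 1`. [cite: Rudin1976, Thm. 3.26] -/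
theorem inv_rpow_lt_one_and_ne_zero {q : ℝ≥0∞} (hq : 1 < q) (hqT : q ≠ ⊤) {κ : ℝ} (hκ : 0 < κ) :
    (q⁻¹) ^ κ ≠ 0 ∧ (q⁻¹) ^ κ < 1 := by
  have hq0 : q ≠ 0 := (zero_lt_one.trans hq).ne'
  have hinv1 : q⁻¹ < 1 := ENNReal.inv_lt_one.2 hq
  have hinv0 : 0 < q⁻¹ := ENNReal.inv_pos.2 hqT
  exact ⟨(ENNReal.rpow_pos hinv0 (ENNReal.inv_ne_top.2 hq0)).ne', ENNReal.rpow_lt_one hinv1 hκ⟩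

end Summit.HodgeConjecture.HodgeConjecture.Cruxes.H413.K2E3GeometricTailSummable

end
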